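import Literature.Probability.LatticeModels.RCPeierls
import HarnessLib

/-!
# Random-cluster contours, VIII: realising an external family by gluing

Topic `Literature/Probability/LatticeModels`. The combinatorial heart of the contour representation
(Friedli–Velenik 2017, §7.3, eqs. (7.29)–(7.30); Grimmett 2006, §7.5, (7.18)–(7.22)) for the thick
random-cluster contours of `RCContours`–`RCGluing`: the configurations `ω ⊆ freeEdges V` of a volume `V`
(with `★`-connected complement, boundary condition `σ`) whose external contours form a given external family
`Γ ∈ ExtFam σ V` are in bijection with the configurations of the *interior edges*
`IntEdges Γ = ⋃_{γ ∈ Γ} ⋃_{A ∈ ints γ} freeEdges A`, through `ω ↦ ω ∩ IntEdges Γ` and the **gluing**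
`U ↦ glue σ V Γ U = base σ V Γ ∪ U`, where `base` consists of the free edges of `V` off `IntEdges Γ` whose
value is *determined* by the family (`OpenFam`: the intrinsic value `γ.IsOpen e` of the member whose hull the
edge touches, the boundary condition off all hulls).

* §1 Intrinsic values of a single well-formed contour off its support: `CompOrd` is the type on the exterior
  and the label on an interior component (`compOrd_iff_type`, `compOrd_iff_lab`), hence the intrinsic value
  of an edge with both endpoints in the exterior / in an interior component (`isOpen_iff_type_of_ext`,
  `isOpen_iff_lab_of_mem`); the **rim lemma** `isOpen_iff_type_of_not_mem_freeEdges`: a contour lying in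
  `V` gives every non-free edge of `V` the value of its type — so every member of `ExtFam σ V` is realizable
  in `V` (FV Lemma 7.20 / eq. (7.26) for edge configurations).
* §2 The family: `IntEdges`, `HullTouch`, `OpenFam`, `SpecFam`, `base`, `glue`; an edge touches at most one
  hull (`eq_of_touch`); near a support the determined value is the member's intrinsic value
  (`openFam_iff_isOpen`), off the free edges it is the boundary condition; the glued configuration is
  *specified*: `EOpen (glue U) e ↔ SpecFam σ Γ U e` on lattice edges (`eOpen_glue_iff`).
* §3 Structure of any specified configuration: on an interior component `A` it is the block configuration
  `U ∩ freeEdges A` with boundary condition `lab A` (`eOpen_iff_eOpen_block`); its bad sites are the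
  intrinsically bad sites of the members and the bad sites of the blocks (`bad_iff_of_spec`, via the
  location trichotomy `location`); its thick bad set (`mem_thick_iff_of_spec`).
* §4 Its supports are the supports of the members and of the blocks (`mem_supports_iff_of_spec`, by
  separation), the hull-maximal ones are the supports of the members (`mem_maxSupports_iff_of_spec`), the
  contour extracted at the support of a member is that member (`contourAt_eq_of_spec`), hence **its external
  contours are `Γ`** (`extContours_eq_of_spec`, `extContours_glue`).
* §5 Conversely a genuine configuration is specified by its own external contours and interior edges
  (`specFam_extContours`, from the agreement lemmas of `RCWeights`) and **is the gluing of them**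
  (`glue_extContours`).

Everything is proved; no named facts.

## References

* S. Friedli, Y. Velenik, *Statistical Mechanics of Lattice Systems*, CUP 2017, §7.2.6 (Def. 7.18,
  Lemma 7.19), §7.3 (Lemma 7.20, Def. 7.22, Lemma 7.23, eqs. (7.26)–(7.30)). [FriedliVelenik2017]
* G. Grimmett, *The Random-Cluster Model*, Springer 2006, §7.5, eqs. (7.18)–(7.22). [Grimmett2006]
-/

noncomputable section

open Finset Relation

namespace Literature.Probability.LatticeModels

namespace RCC

open ContourSetup ClassCount

variable {d : ℕ}

/-! ### 1. Intrinsic values of a well-formed contour off its support -/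

section Intrinsic

variable (hd : 2 ≤ d) (γ : (rcSetup d).Γ)
include hd

omit hd in
/-- The exterior of the support misses the support (as sets). [folklore] -/
theorem starExt_subset_compl : starExt γ.1.supp ⊆ (↑γ.1.supp : Set (Site d))ᶜ := fun _ hw hwS => hw.1 (mem_coe.1 hwS)

/-- **On the exterior component, `CompOrd` is the type.** [cite: FriedliVelenik2017, §7.2.6, Lemma 7.19] -/
theorem compOrd_iff_type {z : Site d} (hz : z ∈ starExt γ.1.supp) : γ.1.CompOrd z ↔ γ.1.type = Phase.ord := by
  obtain ⟨-, -, h3, -, -, h6⟩ := WF.consistency hd γ.2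
  constructor
  · rintro ⟨y', hy'B, hzy'⟩
    exact (h3 y' (h6 hy'B) (mem_starExt_of_reflTransGen hz hzy')).1 hy'B
  · intro ht
    obtain ⟨x, hx⟩ := (rcSetup d).supp_nonempty γ
    obtain ⟨y', hy'⟩ := exBoundary_nonempty (by omega) (T := starHullFinset γ.1.supp)
      ⟨x, (mem_starHullFinset hd).2 (subset_starHull _ (mem_coe.2 hx))⟩
    obtain ⟨hy'b, hy'e⟩ := mem_exBoundary_of_mem_exBoundary_hull hd hy'
    exact ⟨y', (h3 y' hy'b hy'e).2 ht, reflTransGen_starRel_mono (starExt_subset_compl γ) (starConn_starExt hd _ z hz y' hy'e)⟩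

/-- **On an interior component, `CompOrd` is the label.** [cite: FriedliVelenik2017, §7.2.6, Lemma 7.19] -/
theorem compOrd_iff_lab {A : Finset (Site d)} (hA : A ∈ (rcSetup d).ints γ) {z : Site d} (hz : z ∈ A) :
    γ.1.CompOrd z ↔ γ.1.lab A = Phase.ord := by
  obtain ⟨-, -, -, h4, -, h6⟩ := WF.consistency hd γ.2
  obtain ⟨u, hu, rfl⟩ := mem_ints.1 hA
  have hAS : ∀ {y}, y ∈ starIntComp γ.1.supp u → y ∉ γ.1.supp := fun hy => ((mem_starInt hd).1 (starIntComp_subset _ _ hy)).1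
  constructor
  · rintro ⟨y', hy'B, hzy'⟩
    have hy'A : y' ∈ starIntComp γ.1.supp u := (mem_starIntComp hd hu).2 (((mem_starIntComp hd hu).1 hz).trans hzy')
    obtain ⟨-, s, hs, hsy'⟩ := mem_exBoundary.1 (h6 hy'B)
    have hy'in : y' ∈ inBoundary (starIntComp γ.1.supp u) := mem_inBoundary.2 ⟨hy'A, s, fun h => hAS h hs, hsy'.symm⟩
    exact (h4 u hu y' hy'in).1 hy'B
  · intro hlab
    obtain ⟨y', hy'⟩ := inBoundary_nonempty_of_mem_ints hd (γ := γ) hA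
    refine ⟨y', (h4 u hu y' hy').2 hlab, ?_⟩
    have hconn := starConn_starIntComp hd hu z (mem_coe.2 hz) y' (mem_coe.2 (mem_inBoundary.1 hy').1)
    exact reflTransGen_starRel_mono (fun w hw hwS => hAS (mem_coe.1 hw) (mem_coe.1 hwS)) hconn

/-- **An edge with both endpoints in the exterior is intrinsically open iff the type is `ord`.**
[cite: FriedliVelenik2017, §7.2.6 (ω_γ̄ extended by the labels)] -/
theorem isOpen_iff_type_of_ext {u v : Site d} (hu : u ∈ starExt γ.1.supp) (hv : v ∈ starExt γ.1.supp) :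
    γ.1.IsOpen s(u, v) ↔ γ.1.type = Phase.ord := by
  obtain ⟨-, -, -, -, h5, -⟩ := WF.consistency hd γ.2
  have hnn : s(u, v) ∉ nnEdges γ.1.supp := fun h => hu.1 (mk_mem_nnEdges.1 h).2.1
  rw [Contour.IsOpen]
  constructor
  · rintro (h | ⟨-, w, hw, -, hc⟩)
    · exact absurd (h5 h) hnn
    · rcases Sym2.mem_iff.1 hw with rfl | rfl
      · exact (compOrd_iff_type hd γ hu).1 hc
      · exact (compOrd_iff_type hd γ hv).1 hc
  · intro ht
    exact Or.inr ⟨hnn, u, Sym2.mem_mk_left u v, hu.1, (compOrd_iff_type hd γ hu).2 ht⟩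

/-- **An edge with both endpoints in an interior component is intrinsically open iff the label is `ord`.**
[cite: FriedliVelenik2017, §7.2.6 (ω_γ̄ extended by the labels)] -/
theorem isOpen_iff_lab_of_mem {A : Finset (Site d)} (hA : A ∈ (rcSetup d).ints γ) {u v : Site d} (hu : u ∈ A) (hv : v ∈ A) :
    γ.1.IsOpen s(u, v) ↔ γ.1.lab A = Phase.ord := by
  obtain ⟨-, -, -, -, h5, -⟩ := WF.consistency hd γ.2
  have hAS : ∀ {y}, y ∈ A → y ∉ γ.1.supp := fun hy =>
    Finset.disjoint_left.1 (disjoint_supp_of_mem_ints hd (S := rcSetup d) hA) hy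
  have hnn : s(u, v) ∉ nnEdges γ.1.supp := fun h => hAS hu (mk_mem_nnEdges.1 h).2.1
  rw [Contour.IsOpen]
  constructor
  · rintro (h | ⟨-, w, hw, -, hc⟩)
    · exact absurd (h5 h) hnn
    · rcases Sym2.mem_iff.1 hw with rfl | rfl
      · exact (compOrd_iff_lab hd γ hA hu).1 hc
      · exact (compOrd_iff_lab hd γ hA hv).1 hc
  · intro ht
    exact Or.inr ⟨hnn, u, Sym2.mem_mk_left u v, hAS hu, (compOrd_iff_lab hd γ hA hu).2 ht⟩

/-- **Ball edges of an exterior-boundary site in the exterior carry the type.** [cite: FriedliVelenik2017, §7.2.6, Lemma 7.19] -/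
theorem isOpen_iff_type_of_mem_exBoundary_ext {y : Site d} (hy : y ∈ exBoundary γ.1.supp) (hye : y ∈ starExt γ.1.supp)
    {e : Sym2 (Site d)} (he : e ∈ ballEdges y) : γ.1.IsOpen e ↔ γ.1.type = Phase.ord := by
  obtain ⟨-, h2, h3, -, -, -⟩ := WF.consistency hd γ.2
  obtain ⟨-, hog, hdg⟩ := h2 y hy
  have hB := h3 y hy hye
  constructor
  · intro ho
    by_contra ht
    exact (hdg.2 (fun hB' => ht (hB.1 hB'))) e he ho
  · intro ht
    exact (hog.2 (hB.2 ht)) e he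

/-- **Ball edges of an interior-boundary site of an interior component carry the label.** [cite: FriedliVelenik2017, §7.2.6, Lemma 7.19] -/
theorem isOpen_iff_lab_of_mem_inBoundary {A : Finset (Site d)} (hA : A ∈ (rcSetup d).ints γ) {y : Site d} (hy : y ∈ inBoundary A)
    {e : Sym2 (Site d)} (he : e ∈ ballEdges y) : γ.1.IsOpen e ↔ γ.1.lab A = Phase.ord := by
  obtain ⟨-, h2, -, h4, -, -⟩ := WF.consistency hd γ.2
  obtain ⟨u, hu, rfl⟩ := mem_ints.1 hA
  have hyb : y ∈ exBoundary γ.1.supp := by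
    obtain ⟨hyA, w, hwA, hyw⟩ := mem_inBoundary.1 hy
    have hwS : w ∈ γ.1.supp := by
      by_contra hwS; exact hwA (mem_of_adj_of_mem_ints hd (S := rcSetup d) hA hyA hwS hyw)
    exact mem_exBoundary.2 ⟨Finset.disjoint_left.1 (disjoint_supp_of_mem_ints hd (S := rcSetup d) hA) hyA, w, hwS, hyw.symm⟩
  obtain ⟨-, hog, hdg⟩ := h2 y hyb
  have hB := h4 u hu y hy
  constructor
  · intro ho
    by_contra ht
    exact (hdg.2 (fun hB' => ht (hB.1 hB'))) e he ho
  · intro ht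
    exact (hog.2 (hB.2 ht)) e he

omit hd in
/-- Intrinsic type propagation between `★`-adjacent good sites: if `y` is not intrinsically bad and shares
a ball edge with `z`, then `y` is `ord`-good iff that edge is open. [cite: FriedliVelenik2017, §7.2.1] -/
theorem iOrdGood_iff_isOpen_of_not_iBad {y : Site d} (hy : ¬ γ.1.IBad y) {e : Sym2 (Site d)} (he : e ∈ ballEdges y) :
    γ.1.IOrdGood y ↔ γ.1.IsOpen e := by
  constructor
  · intro hg; exact hg e he
  · intro ho
    by_contra hno
    have hdis : γ.1.IDisGood y := by by_contra hnd; exact hy ⟨hno, hnd⟩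
    exact hdis e he ho

/-- **The rim lemma.** For a well-formed contour in the volume `V` (its `★`-neighbourhood inside `V`, `V`
with `★`-connected complement), every lattice edge that is NOT a free edge of `V` is intrinsically open iff
the type is `ord`: the contour is realizable by a configuration of `V` with boundary condition its type.
[cite: FriedliVelenik2017, §7.3, Lemma 7.20 and eq. (7.26)] -/
theorem isOpen_iff_type_of_not_mem_freeEdges {V : Finset (Site d)} (hV : StarConn (V : Set (Site d))ᶜ)
    (hin : (rcSetup d).InVol γ V) {e : Sym2 (Site d)} (heE : e ∈ (zdGraph d).edgeSet) (heF : e ∉ freeEdges V) :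
    γ.1.IsOpen e ↔ γ.1.type = Phase.ord := by
  have hd1 : 1 ≤ d := by omega
  obtain ⟨h1, -, -, -, -, -⟩ := WF.consistency hd γ.2
  -- a site `i` seeing `e` whose radius-2 ball leaves `V`, a point `w ∉ V` and a midpoint `z`
  obtain ⟨i, hi, hic⟩ : ∃ i ∈ coBall e, i ∉ core V := by
    by_contra hall; push Not at hall; exact heF (mem_freeEdges.2 ⟨heE, hall⟩)
  obtain ⟨w, hw, hwV⟩ : ∃ w ∈ starBall2 i, w ∉ V := by
    by_contra hall; push Not at hall; exact hic (mem_core.2 hall)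
  have hei : e ∈ ballEdges i := mem_ballEdges_iff.2 ⟨heE, hi⟩
  have hhull : (rcSetup d).hull γ ⊆ V := hull_subset_of_inVol hd hV hin
  have hwe : w ∈ starExt γ.1.supp := by
    by_contra h; exact hwV (hhull ((mem_starHullFinset hd).2 h))
  have hballV : ∀ {s}, s ∈ γ.1.supp → starBall s ⊆ V := fun hs => (subset_biUnion_of_mem starBall hs).trans hin
  obtain ⟨z, hiz, hzw⟩ := exists_midpoint (mem_starBall2.1 hw)
  have hzS : z ∉ γ.1.supp := fun hzS => hwV (hballV hzS (mem_starBall.2 hzw))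
  have hze : z ∈ starExt γ.1.supp := by
    by_cases hzw' : w = z
    · exact hzw' ▸ hwe
    · exact mem_starExt_of_reflTransGen hwe (ReflTransGen.single ⟨zdStar_adj.2 ⟨hzw', by rwa [supDist_comm]⟩,
        starExt_subset_compl γ hwe, fun h => hzS (mem_coe.1 h)⟩)
  by_cases hiS : i ∈ γ.1.supp
  · -- (a) `i` on the support: not bad (its ball leaves the support at `z`), hence good of the type of `z`
    have hzi : z ∈ starBall i := mem_starBall.2 hiz
    have hnb : ¬ γ.1.IBad i := fun hb => hzS ((h1 z).2 ⟨i, hiS, hb, hzi⟩)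
    have hzi' : z ≠ i := fun h => hzS (h ▸ hiS)
    have hzb : z ∈ exBoundary γ.1.supp := mem_exBoundary.2 ⟨hzS, i, hiS, adj_iff_mem_starBall.2 ⟨hzi, hzi'.symm⟩⟩
    obtain ⟨e', he'i, he'z⟩ := exists_mem_ballEdges_inter hd1 hiz
    rw [← iOrdGood_iff_isOpen_of_not_iBad γ hnb hei, iOrdGood_iff_isOpen_of_not_iBad γ hnb he'i]
    exact isOpen_iff_type_of_mem_exBoundary_ext hd γ hzb hze he'z
  · -- (b) `i` off the support: it is exterior
    have hie : i ∈ starExt γ.1.supp := by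
      rcases mem_starExt_or_mem_starInt hd hiS with h | h
      · exact h
      · exfalso
        have hA : starIntComp γ.1.supp i ∈ (rcSetup d).ints γ := mem_ints.2 ⟨i, h, rfl⟩
        have hzh : z ∈ (rcSetup d).hull γ := starBall_subset_hull_of_mem_ints hd hA (mem_starIntComp_self hd h) (mem_starBall.2 hiz)
        exact ((mem_starHullFinset hd).1 hzh) hze
    by_cases hib : i ∈ exBoundary γ.1.supp
    · exact isOpen_iff_type_of_mem_exBoundary_ext hd γ hib hie hei
    · -- no support site in the ball of `i`: both endpoints of `e` are exterior
      have hfar : ∀ u ∈ starBall i, u ∈ starExt γ.1.supp := by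
        intro u hu
        by_cases hui : i = u
        · exact hui ▸ hie
        · have huS : u ∉ γ.1.supp := fun huS => hib (mem_exBoundary.2 ⟨hiS, u, huS, adj_iff_mem_starBall.2 ⟨mem_starBall_comm.1 hu, fun h => hui h.symm⟩⟩)
          exact mem_starExt_of_reflTransGen hie (ReflTransGen.single ⟨adj_iff_mem_starBall.2 ⟨hu, hui⟩,
            starExt_subset_compl γ hie, fun h => huS (mem_coe.1 h)⟩)
      have hends := mem_coBall_iff.1 hi
      induction e using Sym2.ind with
      | h u v => exact isOpen_iff_type_of_ext hd γ (hfar u (hends u (Sym2.mem_mk_left u v))) (hfar v (hends v (Sym2.mem_mk_right u v)))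

end Intrinsic

/-! ### 2. External families in a volume: determined edges and the glued configuration -/

section Family

variable (hd : 2 ≤ d) {σ : Phase} {V : Finset (Site d)} (hV : StarConn (V : Set (Site d))ᶜ)
  {Γ : Finset (rcSetup d).Γ} (hΓ : Γ ∈ (rcSetup d).ExtFam σ V)

/-- **The interior edges of a family**: the free edges of the interior components of its members (the
edges left free once the family is fixed). [cite: FriedliVelenik2017, §7.3, eqs. (7.29)–(7.30)] -/
def IntEdges (Γ : Finset (rcSetup d).Γ) : Finset (Sym2 (Site d)) := (Γ.biUnion (rcSetup d).ints).biUnion freeEdges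

/-- An edge touches the hull of a member of the family. [folklore] -/
def HullTouch (Γ : Finset (rcSetup d).Γ) (e : Sym2 (Site d)) : Prop := ∃ γ ∈ Γ, ∃ z ∈ e, z ∈ (rcSetup d).hull γ

/-- **The value of a non-interior edge determined by the family**: the intrinsic value of the member whose
hull it touches, and the boundary condition off all hulls. [cite: FriedliVelenik2017, §7.3, proof of (7.28)–(7.30)] -/
def OpenFam (σ : Phase) (Γ : Finset (rcSetup d).Γ) (e : Sym2 (Site d)) : Prop :=
  (∃ γ ∈ Γ, (∃ z ∈ e, z ∈ (rcSetup d).hull γ) ∧ γ.1.IsOpen e) ∨ (¬ HullTouch Γ e ∧ σ = Phase.ord)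

/-- **The specification of a configuration by the family and the interior edges `U`.**
[cite: FriedliVelenik2017, §7.3, eqs. (7.29)–(7.30)] -/
def SpecFam (σ : Phase) (Γ : Finset (rcSetup d).Γ) (U : Finset (Sym2 (Site d))) (e : Sym2 (Site d)) : Prop :=
  (e ∈ IntEdges Γ ∧ e ∈ U) ∨ (e ∉ IntEdges Γ ∧ OpenFam σ Γ e)

/-- The determined open free edges of the volume. [cite: FriedliVelenik2017, §7.3] -/
def base (σ : Phase) (V : Finset (Site d)) (Γ : Finset (rcSetup d).Γ) : Finset (Sym2 (Site d)) := by
  classical exact (freeEdges V \ IntEdges Γ).filter (OpenFam σ Γ)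

/-- **The glued configuration** of the family with interior edges `U`. [cite: FriedliVelenik2017, §7.3] -/
def glue (σ : Phase) (V : Finset (Site d)) (Γ : Finset (rcSetup d).Γ) (U : Finset (Sym2 (Site d))) : Finset (Sym2 (Site d)) :=
  base σ V Γ ∪ U

/-- Membership in `IntEdges`. [folklore] -/
theorem mem_IntEdges {e : Sym2 (Site d)} : e ∈ IntEdges Γ ↔ ∃ γ ∈ Γ, ∃ A ∈ (rcSetup d).ints γ, e ∈ freeEdges A := by
  simp only [IntEdges, mem_biUnion]
  constructor
  · rintro ⟨A, ⟨γ, hγ, hA⟩, he⟩; exact ⟨γ, hγ, A, hA, he⟩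
  · rintro ⟨γ, hγ, A, hA, he⟩; exact ⟨A, ⟨γ, hγ, hA⟩, he⟩

/-! #### Accessors for external families -/

/-- Members have the type of the family. [folklore] -/
theorem type_eq_of_mem (hΓ : Γ ∈ (rcSetup d).ExtFam σ V) {γ : (rcSetup d).Γ} (hγ : γ ∈ Γ) : (rcSetup d).type γ = σ :=
  ((mem_compFam.1 (mem_extFam.1 hΓ).1).1 γ hγ).1

/-- Members have the type of the family (intrinsic form). [folklore] -/
theorem type_eq_of_mem' (hΓ : Γ ∈ (rcSetup d).ExtFam σ V) {γ : (rcSetup d).Γ} (hγ : γ ∈ Γ) : γ.1.type = σ :=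
  type_eq_of_mem hΓ hγ

/-- Members lie in the volume. [folklore] -/
theorem inVol_of_mem (hΓ : Γ ∈ (rcSetup d).ExtFam σ V) {γ : (rcSetup d).Γ} (hγ : γ ∈ Γ) : (rcSetup d).InVol γ V :=
  ((mem_compFam.1 (mem_extFam.1 hΓ).1).1 γ hγ).2

/-- Distinct members have supports at `d_∞`-distance `> 1`. [folklore] -/
theorem compat_of_mem (hΓ : Γ ∈ (rcSetup d).ExtFam σ V) {γ γ' : (rcSetup d).Γ} (hγ : γ ∈ Γ) (hγ' : γ' ∈ Γ) (hne : γ ≠ γ') :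
    (rcSetup d).Compat γ γ' := (mem_compFam.1 (mem_extFam.1 hΓ).1).2 (mem_coe.2 hγ) (mem_coe.2 hγ') hne

/-- Distinct members have disjoint hulls. [folklore] -/
theorem disjoint_hull_of_mem (hΓ : Γ ∈ (rcSetup d).ExtFam σ V) {γ γ' : (rcSetup d).Γ} (hγ : γ ∈ Γ) (hγ' : γ' ∈ Γ) (hne : γ ≠ γ') :
    Disjoint ((rcSetup d).hull γ) ((rcSetup d).hull γ') := (mem_extFam.1 hΓ).2 (mem_coe.2 hγ) (mem_coe.2 hγ') hne

include hd hV in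
/-- Hulls of members lie in the volume. [folklore] -/
theorem hull_subset_of_mem (hΓ : Γ ∈ (rcSetup d).ExtFam σ V) {γ : (rcSetup d).Γ} (hγ : γ ∈ Γ) : (rcSetup d).hull γ ⊆ V :=
  hull_subset_of_inVol hd hV (inVol_of_mem hΓ hγ)

include hd hV in
/-- Interior edges are free edges of the volume. [folklore] -/
theorem IntEdges_subset (hΓ : Γ ∈ (rcSetup d).ExtFam σ V) : IntEdges Γ ⊆ freeEdges V := by
  intro e he
  obtain ⟨γ, hγ, A, hA, he⟩ := (mem_IntEdges).1 he
  exact freeEdges_mono ((subset_intr_of_mem_ints (S := rcSetup d) hA).trans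
    ((intr_subset_hull (S := rcSetup d) γ).trans (hull_subset_of_mem hd hV hΓ hγ))) he

/-! #### Geometry of an external family -/

/-- A point lies in the hull of at most one member. [folklore] -/
theorem eq_of_mem_hull (hΓ : Γ ∈ (rcSetup d).ExtFam σ V) {γ γ' : (rcSetup d).Γ} (hγ : γ ∈ Γ) (hγ' : γ' ∈ Γ) {x : Site d}
    (hx : x ∈ (rcSetup d).hull γ) (hx' : x ∈ (rcSetup d).hull γ') : γ = γ' := by
  by_contra hne
  exact Finset.disjoint_left.1 (disjoint_hull_of_mem hΓ hγ hγ' hne) hx hx'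

include hd in
/-- A hull point `★`-adjacent to a point off the hull is a support point. [folklore] -/
theorem mem_supp_of_adj_not_mem_hull {γ : (rcSetup d).Γ} {x y : Site d} (hx : x ∈ (rcSetup d).hull γ) (hy : y ∉ (rcSetup d).hull γ)
    (hxy : (zdStar d).Adj x y) : x ∈ γ.1.supp := by
  rcases (mem_hull_iff hd (S := rcSetup d)).1 hx with h | h
  · exact h
  · exfalso
    obtain ⟨A, hA, hxA⟩ := (mem_intr_iff_exists_ints hd (S := rcSetup d)).1 h
    exact hy (starBall_subset_hull_of_mem_ints hd hA hxA (adj_iff_mem_starBall.1 hxy).1)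

/-- Support points of distinct members are not within `d_∞`-distance `1`. [folklore] -/
theorem one_lt_supDist_of_mem (hΓ : Γ ∈ (rcSetup d).ExtFam σ V) {γ γ' : (rcSetup d).Γ} (hγ : γ ∈ Γ) (hγ' : γ' ∈ Γ) (hne : γ ≠ γ')
    {x y : Site d} (hx : x ∈ γ.1.supp) (hy : y ∈ γ'.1.supp) : 1 < supDist x y := compat_of_mem hΓ hγ hγ' hne x hx y hy

/-- A point off a hull is exterior to the support. [folklore] -/
theorem mem_starExt_of_not_mem_hull (hd : 2 ≤ d) {γ : (rcSetup d).Γ} {x : Site d} (hx : x ∉ (rcSetup d).hull γ) : x ∈ starExt γ.1.supp := by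
  by_contra h; exact hx ((mem_starHullFinset hd).2 h)

include hd in
/-- **An edge touches the hull of at most one member.** [folklore] -/
theorem eq_of_touch (hΓ : Γ ∈ (rcSetup d).ExtFam σ V) {γ γ' : (rcSetup d).Γ} (hγ : γ ∈ Γ) (hγ' : γ' ∈ Γ) {e : Sym2 (Site d)}
    (he : e ∈ (zdGraph d).edgeSet) {z z' : Site d} (hz : z ∈ e) (hzh : z ∈ (rcSetup d).hull γ) (hz' : z' ∈ e) (hz'h : z' ∈ (rcSetup d).hull γ') :
    γ = γ' := by
  by_contra hne
  induction e using Sym2.ind with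
  | h u v =>
    rw [SimpleGraph.mem_edgeSet] at he
    have key : ∀ {a b : Site d} {γ₁ γ₂ : (rcSetup d).Γ}, γ₁ ∈ Γ → γ₂ ∈ Γ → γ₁ ≠ γ₂ → (zdGraph d).Adj a b →
        a ∈ (rcSetup d).hull γ₁ → b ∈ (rcSetup d).hull γ₂ → False := by
      intro a b γ₁ γ₂ h₁ h₂ h12 hab ha hb
      have hb1 : b ∉ (rcSetup d).hull γ₁ := fun h => h12 (eq_of_mem_hull hΓ h₁ h₂ h hb)
      have ha2 : a ∉ (rcSetup d).hull γ₂ := fun h => h12 (eq_of_mem_hull hΓ h₁ h₂ ha h)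
      have haS := mem_supp_of_adj_not_mem_hull hd ha hb1 (zdGraph_le_zdStar hab)
      have hbS := mem_supp_of_adj_not_mem_hull hd hb ha2 (zdGraph_le_zdStar hab.symm)
      exact absurd (zdStar_adj.1 (zdGraph_le_zdStar hab)).2 (not_le.2 (one_lt_supDist_of_mem hΓ h₁ h₂ h12 haS hbS))
    rcases Sym2.mem_iff.1 hz with rfl | rfl <;> rcases Sym2.mem_iff.1 hz' with rfl | rfl
    · exact hne (eq_of_mem_hull hΓ hγ hγ' hzh hz'h)
    · exact key hγ hγ' hne he hzh hz'h
    · exact key hγ' hγ (Ne.symm hne) he hz'h hzh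
    · exact hne (eq_of_mem_hull hΓ hγ hγ' hzh hz'h)

include hd in
/-- **A site near the support of `γ` that sees the hull of another member `γ'` lies on the exterior
boundaries of both supports, in both exteriors.** [folklore] -/
theorem near_two (hΓ : Γ ∈ (rcSetup d).ExtFam σ V) {γ γ' : (rcSetup d).Γ} (hγ : γ ∈ Γ) (hγ' : γ' ∈ Γ) (hne : γ ≠ γ')
    {x : Site d} (hx : x ∈ γ.1.supp ∨ x ∈ exBoundary γ.1.supp) {z : Site d} (hz : z ∈ starBall x) (hzh : z ∈ (rcSetup d).hull γ') :
    (x ∈ exBoundary γ.1.supp ∧ x ∈ starExt γ.1.supp) ∧ (x ∈ exBoundary γ'.1.supp ∧ x ∈ starExt γ'.1.supp) := by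
  -- `x` is off the hull of `γ'`
  have hxh' : x ∉ (rcSetup d).hull γ' := by
    intro hxh'
    rcases hx with hxS | hxb
    · exact hne (eq_of_mem_hull hΓ hγ hγ' (supp_subset_hull hd (S := rcSetup d) γ hxS) hxh')
    · obtain ⟨hxS, s, hs, hsx⟩ := mem_exBoundary.1 hxb
      have hsh' : s ∉ (rcSetup d).hull γ' := fun h => hne (eq_of_mem_hull hΓ hγ hγ' (supp_subset_hull hd (S := rcSetup d) γ hs) h)
      have hxS' := mem_supp_of_adj_not_mem_hull hd hxh' hsh' hsx.symm
      exact absurd (zdStar_adj.1 hsx).2 (not_le.2 (one_lt_supDist_of_mem hΓ hγ hγ' hne hs hxS'))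
  have hzx : z ≠ x := fun h => hxh' (h ▸ hzh)
  have hxz : (zdStar d).Adj z x := adj_iff_mem_starBall.2 ⟨mem_starBall_comm.1 hz, hzx⟩
  have hzS' : z ∈ γ'.1.supp := mem_supp_of_adj_not_mem_hull hd hzh hxh' hxz
  have hxb' : x ∈ exBoundary γ'.1.supp := mem_exBoundary.2 ⟨fun h => hxh' (supp_subset_hull hd (S := rcSetup d) γ' h), z, hzS', hxz⟩
  -- `x` is off the support of `γ`, and not interior
  have hxS : x ∉ γ.1.supp := fun hxS => absurd (zdStar_adj.1 hxz).2 (by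
    rw [supDist_comm]; exact not_le.2 (one_lt_supDist_of_mem hΓ hγ hγ' hne hxS hzS'))
  have hxb : x ∈ exBoundary γ.1.supp := hx.resolve_left hxS
  have hxe : x ∈ starExt γ.1.supp := by
    rcases mem_starExt_or_mem_starInt hd hxS with h | h
    · exact h
    · exfalso
      have hA : starIntComp γ.1.supp x ∈ (rcSetup d).ints γ := mem_ints.2 ⟨x, h, rfl⟩
      have hzh0 : z ∈ (rcSetup d).hull γ := starBall_subset_hull_of_mem_ints hd hA (mem_starIntComp_self hd h) hz
      exact hne (eq_of_mem_hull hΓ hγ hγ' hzh0 hzh)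
  exact ⟨⟨hxb, hxe⟩, hxb', mem_starExt_of_not_mem_hull hd hxh'⟩

include hd in
/-- **An edge in the ball of a site near a support that touches no hull is intrinsically open iff the type
of the family is `ord`.** [folklore] -/
theorem isOpen_iff_of_not_touch (hΓ : Γ ∈ (rcSetup d).ExtFam σ V) {γ : (rcSetup d).Γ} (hγ : γ ∈ Γ) {e : Sym2 (Site d)}
    (he : e ∈ (zdGraph d).edgeSet) (hnt : ¬ HullTouch Γ e) : γ.1.IsOpen e ↔ σ = Phase.ord := by
  have hext : ∀ z ∈ e, z ∈ starExt γ.1.supp := fun z hz =>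
    mem_starExt_of_not_mem_hull hd fun h => hnt ⟨γ, hγ, z, hz, h⟩
  rw [← type_eq_of_mem' hΓ hγ]
  induction e using Sym2.ind with
  | h u v => exact isOpen_iff_type_of_ext hd γ (hext u (Sym2.mem_mk_left u v)) (hext v (Sym2.mem_mk_right u v))

include hd in
/-- **Near a support the family-determined value is the member's intrinsic value.** For `x` on the support
of `γ ∈ Γ` or on its exterior boundary and `e` an edge of the ball of `x`: `e` is not an interior edge, and
`OpenFam σ Γ e ↔ γ.IsOpen e`. [cite: FriedliVelenik2017, §7.3, proof of (7.28)] -/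
theorem openFam_iff_isOpen (hΓ : Γ ∈ (rcSetup d).ExtFam σ V) {γ : (rcSetup d).Γ} (hγ : γ ∈ Γ) {x : Site d}
    (hx : x ∈ γ.1.supp ∨ x ∈ exBoundary γ.1.supp) {e : Sym2 (Site d)} (he : e ∈ ballEdges x) :
    e ∉ IntEdges Γ ∧ (OpenFam σ Γ e ↔ γ.1.IsOpen e) := by
  obtain ⟨heE, hxe⟩ := mem_ballEdges_iff.1 he
  have hσ := type_eq_of_mem' hΓ hγ
  -- transfer between two members seen from `x`
  have transfer : ∀ {γ' : (rcSetup d).Γ}, γ' ∈ Γ → ∀ {z}, z ∈ e → z ∈ (rcSetup d).hull γ' → (γ'.1.IsOpen e ↔ γ.1.IsOpen e) := by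
    intro γ' hγ' z hz hzh
    by_cases hne : γ = γ'
    · subst hne; exact Iff.rfl
    obtain ⟨⟨hxb, hxe'⟩, hxb', hxe''⟩ := near_two hd hΓ hγ hγ' hne hx (mem_coBall_iff.1 hxe z hz) hzh
    rw [isOpen_iff_type_of_mem_exBoundary_ext hd γ' hxb' hxe'' he, isOpen_iff_type_of_mem_exBoundary_ext hd γ hxb hxe' he,
      type_eq_of_mem' hΓ hγ', hσ]
  refine ⟨fun hI => ?_, ⟨?_, fun ho => ?_⟩⟩
  · -- not an interior edge: `x` would lie in the core of an interior component
    obtain ⟨γ', hγ', A, hA, heA⟩ := (mem_IntEdges).1 hI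
    have hxA : starBall x ⊆ A := (starBall_subset_inner1_of_mem_core ((mem_freeEdges.1 heA).2 hxe)).trans (inner1_subset A)
    have hAS : Disjoint A γ'.1.supp := disjoint_supp_of_mem_ints hd (S := rcSetup d) hA
    have hAh : A ⊆ (rcSetup d).hull γ' := (subset_intr_of_mem_ints (S := rcSetup d) hA).trans (intr_subset_hull (S := rcSetup d) γ')
    rcases hx with hxS | hxb
    · have := eq_of_mem_hull hΓ hγ hγ' (supp_subset_hull hd (S := rcSetup d) γ hxS) (hAh (hxA (mem_starBall_self x)))
      subst this
      exact Finset.disjoint_left.1 hAS (hxA (mem_starBall_self x)) hxS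
    · obtain ⟨-, s, hs, hsx⟩ := mem_exBoundary.1 hxb
      have hsA : s ∈ A := hxA (mem_starBall_comm.1 (adj_iff_mem_starBall.1 hsx).1)
      have := eq_of_mem_hull hΓ hγ hγ' (supp_subset_hull hd (S := rcSetup d) γ hs) (hAh hsA)
      subst this
      exact Finset.disjoint_left.1 hAS hsA hs
  · rintro (⟨γ', hγ', ⟨z, hz, hzh⟩, ho⟩ | ⟨hnt, hσo⟩)
    · exact (transfer hγ' hz hzh).1 ho
    · exact (isOpen_iff_of_not_touch hd hΓ hγ heE hnt).2 hσo
  · by_cases ht : HullTouch Γ e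
    · obtain ⟨γ', hγ', z, hz, hzh⟩ := ht
      exact Or.inl ⟨γ', hγ', ⟨z, hz, hzh⟩, (transfer hγ' hz hzh).2 ho⟩
    · exact Or.inr ⟨ht, (isOpen_iff_of_not_touch hd hΓ hγ heE ht).1 ho⟩

include hd hV in
/-- **Off the free edges the family-determined value is the boundary condition.** [cite: FriedliVelenik2017, §7.3, Lemma 7.20] -/
theorem specFam_iff_of_not_mem_freeEdges (hΓ : Γ ∈ (rcSetup d).ExtFam σ V) (U : Finset (Sym2 (Site d))) {e : Sym2 (Site d)}
    (heE : e ∈ (zdGraph d).edgeSet) (heF : e ∉ freeEdges V) : SpecFam σ Γ U e ↔ σ = Phase.ord := by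
  have hI : e ∉ IntEdges Γ := fun h => heF (IntEdges_subset hd hV hΓ h)
  rw [SpecFam, OpenFam]
  constructor
  · rintro (⟨h, -⟩ | ⟨-, ⟨γ, hγ, -, ho⟩ | ⟨-, h⟩⟩)
    · exact absurd h hI
    · rw [← type_eq_of_mem' hΓ hγ]
      exact (isOpen_iff_type_of_not_mem_freeEdges hd γ hV (inVol_of_mem hΓ hγ) heE heF).1 ho
    · exact h
  · intro hσ
    refine Or.inr ⟨hI, ?_⟩
    by_cases ht : HullTouch Γ e
    · obtain ⟨γ, hγ, z, hz, hzh⟩ := ht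
      refine Or.inl ⟨γ, hγ, ⟨z, hz, hzh⟩, ?_⟩
      rw [isOpen_iff_type_of_not_mem_freeEdges hd γ hV (inVol_of_mem hΓ hγ) heE heF, type_eq_of_mem' hΓ hγ, hσ]
    · exact Or.inr ⟨ht, hσ⟩

/-- `base ⊆ freeEdges V ∖ IntEdges Γ`, and its members are `OpenFam`. [folklore] -/
theorem mem_base {e : Sym2 (Site d)} : e ∈ base σ V Γ ↔ (e ∈ freeEdges V ∧ e ∉ IntEdges Γ) ∧ OpenFam σ Γ e := by
  classical
  rw [base, mem_filter, mem_sdiff]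

include hd hV in
/-- The glued configuration lies on the free edges. [folklore] -/
theorem glue_subset (hΓ : Γ ∈ (rcSetup d).ExtFam σ V) {U : Finset (Sym2 (Site d))} (hU : U ⊆ IntEdges Γ) : glue σ V Γ U ⊆ freeEdges V := by
  intro e he
  rcases mem_union.1 he with h | h
  · exact ((mem_base).1 h).1.1
  · exact IntEdges_subset hd hV hΓ (hU h)

/-- The glued configuration meets the interior edges in `U`. [folklore] -/
theorem glue_inter_IntEdges {U : Finset (Sym2 (Site d))} (hU : U ⊆ IntEdges Γ) : glue σ V Γ U ∩ IntEdges Γ = U := by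
  ext e
  rw [mem_inter, glue, mem_union, mem_base]
  constructor
  · rintro ⟨(⟨⟨-, h⟩, -⟩ | h), hI⟩
    · exact absurd hI h
    · exact h
  · intro h; exact ⟨Or.inr h, hU h⟩

include hd hV in
/-- **The glued configuration is specified by the family and `U`** (on lattice edges). [cite: FriedliVelenik2017, §7.3] -/
theorem eOpen_glue_iff (hΓ : Γ ∈ (rcSetup d).ExtFam σ V) {U : Finset (Sym2 (Site d))} (hU : U ⊆ IntEdges Γ) {e : Sym2 (Site d)}
    (heE : e ∈ (zdGraph d).edgeSet) : EOpen σ (freeEdges V) (glue σ V Γ U) e ↔ SpecFam σ Γ U e := by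
  by_cases heF : e ∈ freeEdges V
  · rw [eOpen_iff_of_mem heF, glue, mem_union, mem_base, SpecFam]
    constructor
    · rintro (⟨⟨-, hI⟩, ho⟩ | h)
      · exact Or.inr ⟨hI, ho⟩
      · exact Or.inl ⟨hU h, h⟩
    · rintro (⟨-, h⟩ | ⟨hI, ho⟩)
      · exact Or.inr h
      · exact Or.inl ⟨⟨heF, hI⟩, ho⟩
  · rw [eOpen_iff_of_not_mem (glue_subset hd hV hΓ hU) heF, specFam_iff_of_not_mem_freeEdges hd hV hΓ U heE heF]

include hd in
/-- **Near a support, a specified configuration takes the member's intrinsic values.**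
[cite: FriedliVelenik2017, §7.3, proof of (7.28)] -/
theorem eOpen_iff_isOpen_of_spec (hΓ : Γ ∈ (rcSetup d).ExtFam σ V) {U ω : Finset (Sym2 (Site d))}
    (hspec : ∀ e ∈ (zdGraph d).edgeSet, EOpen σ (freeEdges V) ω e ↔ SpecFam σ Γ U e)
    {γ : (rcSetup d).Γ} (hγ : γ ∈ Γ) {x : Site d} (hx : x ∈ γ.1.supp ∨ x ∈ exBoundary γ.1.supp) {e : Sym2 (Site d)} (he : e ∈ ballEdges x) :
    EOpen σ (freeEdges V) ω e ↔ γ.1.IsOpen e := by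
  obtain ⟨hI, ho⟩ := openFam_iff_isOpen hd hΓ hγ hx he
  rw [hspec e (mem_ballEdges_iff.1 he).1, SpecFam, ← ho]
  constructor
  · rintro (⟨h, -⟩ | ⟨-, h⟩)
    · exact absurd h hI
    · exact h
  · intro h; exact Or.inr ⟨hI, h⟩

end Family

/-! ### 3. The structure of a specified configuration -/

section Specified

variable (hd : 2 ≤ d) {σ : Phase} {V : Finset (Site d)} (hV : StarConn (V : Set (Site d))ᶜ)
  {Γ : Finset (rcSetup d).Γ} (hΓ : Γ ∈ (rcSetup d).ExtFam σ V)
  {U ω : Finset (Sym2 (Site d))} (hω : ω ⊆ freeEdges V)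
  (hspec : ∀ e ∈ (zdGraph d).edgeSet, EOpen σ (freeEdges V) ω e ↔ SpecFam σ Γ U e)

/-- Two interior components of members of the family that share a point coincide, and so do the members.
[folklore] -/
theorem eq_of_mem_ints_of_mem (hΓ : Γ ∈ (rcSetup d).ExtFam σ V) (hd : 2 ≤ d) {γ γ' : (rcSetup d).Γ} (hγ : γ ∈ Γ) (hγ' : γ' ∈ Γ)
    {A A' : Finset (Site d)} (hA : A ∈ (rcSetup d).ints γ) (hA' : A' ∈ (rcSetup d).ints γ') {x : Site d} (hx : x ∈ A) (hx' : x ∈ A') :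
    γ = γ' ∧ A = A' := by
  have hAh : A ⊆ (rcSetup d).hull γ := (subset_intr_of_mem_ints (S := rcSetup d) hA).trans (intr_subset_hull (S := rcSetup d) γ)
  have hAh' : A' ⊆ (rcSetup d).hull γ' := (subset_intr_of_mem_ints (S := rcSetup d) hA').trans (intr_subset_hull (S := rcSetup d) γ')
  have hγγ' := eq_of_mem_hull hΓ hγ hγ' (hAh hx) (hAh' hx')
  subst hγγ'
  refine ⟨rfl, ?_⟩
  by_contra hne
  exact Finset.disjoint_left.1 (disjoint_of_mem_ints hd (S := rcSetup d) hA hA' hne) hx hx'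

include hd hspec in
/-- **On an interior component a specified configuration is the block configuration** `U ∩ freeEdges A` with
boundary condition the label. [cite: FriedliVelenik2017, §7.3.1 (ω = η^{#'} on thinned interiors)] -/
theorem eOpen_iff_eOpen_block (hΓ : Γ ∈ (rcSetup d).ExtFam σ V) {γ : (rcSetup d).Γ} (hγ : γ ∈ Γ) {A : Finset (Site d)}
    (hA : A ∈ (rcSetup d).ints γ) {u v : Site d} (huv : (zdGraph d).Adj u v) (hu : u ∈ A) (hv : v ∈ A) :
    EOpen σ (freeEdges V) ω s(u, v) ↔ EOpen (γ.1.lab A) (freeEdges A) (U ∩ freeEdges A) s(u, v) := by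
  have heE : s(u, v) ∈ (zdGraph d).edgeSet := (SimpleGraph.mem_edgeSet _).2 huv
  rw [hspec _ heE, SpecFam]
  by_cases heA : s(u, v) ∈ freeEdges A
  · have hI : s(u, v) ∈ IntEdges Γ := (mem_IntEdges).2 ⟨γ, hγ, A, hA, heA⟩
    rw [eOpen_iff_of_mem heA, mem_inter]
    constructor
    · rintro (⟨-, h⟩ | ⟨h, -⟩)
      · exact ⟨h, heA⟩
      · exact absurd hI h
    · rintro ⟨h, -⟩; exact Or.inl ⟨hI, h⟩
  · have hI : s(u, v) ∉ IntEdges Γ := by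
      intro hI
      obtain ⟨γ', hγ', A', hA', he'⟩ := (mem_IntEdges).1 hI
      have huA' : u ∈ A' := by
        have := (mem_freeEdges.1 he').2 (mem_coBall_of_mem heE (Sym2.mem_mk_left u v))
        exact inner1_subset A' (core_subset_inner1 A' this)
      obtain ⟨rfl, rfl⟩ := eq_of_mem_ints_of_mem hΓ hd hγ hγ' hA hA' hu huA'
      exact heA he'
    rw [eOpen_iff_of_not_mem inter_subset_right heA, ← isOpen_iff_lab_of_mem hd γ hA hu hv, OpenFam]
    have hAh : A ⊆ (rcSetup d).hull γ := (subset_intr_of_mem_ints (S := rcSetup d) hA).trans (intr_subset_hull (S := rcSetup d) γ)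
    constructor
    · rintro (⟨h, -⟩ | ⟨-, ⟨γ', hγ', ⟨z, hz, hzh⟩, ho⟩ | ⟨hnt, -⟩⟩)
      · exact absurd h hI
      · have := eq_of_touch hd hΓ hγ hγ' heE (Sym2.mem_mk_left u v) (hAh hu) hz hzh
        subst this; exact ho
      · exact absurd ⟨γ, hγ, u, Sym2.mem_mk_left u v, hAh hu⟩ hnt
    · intro ho
      exact Or.inr ⟨hI, Or.inl ⟨γ, hγ, ⟨u, Sym2.mem_mk_left u v, hAh hu⟩, ho⟩⟩

include hd hspec in
/-- **Near a support the badness of a specified configuration is the intrinsic one.** [cite: FriedliVelenik2017, §7.2.6] -/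
theorem bad_iff_iBad_of_spec (hΓ : Γ ∈ (rcSetup d).ExtFam σ V) {γ : (rcSetup d).Γ} (hγ : γ ∈ Γ) {x : Site d}
    (hx : x ∈ γ.1.supp ∨ x ∈ exBoundary γ.1.supp) : Bad σ (freeEdges V) ω x ↔ γ.1.IBad x := by
  have h : ∀ e ∈ ballEdges x, (EOpen σ (freeEdges V) ω e ↔ γ.1.IsOpen e) := fun e he =>
    eOpen_iff_isOpen_of_spec hd hΓ hspec hγ hx he
  exact Iff.and (not_congr (forall₂_congr h)) (not_congr (forall₂_congr fun e he => not_congr (h e he)))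

include hd hspec in
/-- **Deep inside an interior component the badness of a specified configuration is that of the block
configuration.** [cite: FriedliVelenik2017, §7.3.1] -/
theorem bad_iff_bad_block_of_spec (hΓ : Γ ∈ (rcSetup d).ExtFam σ V) {γ : (rcSetup d).Γ} (hγ : γ ∈ Γ) {A : Finset (Site d)}
    (hA : A ∈ (rcSetup d).ints γ) {x : Site d} (hx : starBall x ⊆ A) :
    Bad σ (freeEdges V) ω x ↔ Bad (γ.1.lab A) (freeEdges A) (U ∩ freeEdges A) x := by
  have h : ∀ e ∈ ballEdges x, (EOpen σ (freeEdges V) ω e ↔ EOpen (γ.1.lab A) (freeEdges A) (U ∩ freeEdges A) e) := by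
    intro e he
    obtain ⟨heE, hxe⟩ := mem_ballEdges_iff.1 he
    have hends := mem_coBall_iff.1 hxe
    induction e using Sym2.ind with
    | h u v =>
      exact eOpen_iff_eOpen_block hd hspec hΓ hγ hA ((SimpleGraph.mem_edgeSet _).1 heE)
        (hx (hends u (Sym2.mem_mk_left u v))) (hx (hends v (Sym2.mem_mk_right u v)))
  exact Iff.and (not_congr (forall₂_congr h)) (not_congr (forall₂_congr fun e he => not_congr (h e he)))

include hspec in
/-- **Far from all hulls a specified configuration is the pure phase**: such a site is not bad. [cite: FriedliVelenik2017, §7.3, Lemma 7.23] -/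
theorem not_bad_of_far {x : Site d} (hfar : ∀ γ ∈ Γ, ∀ z ∈ starBall x, z ∉ (rcSetup d).hull γ) :
    ¬ Bad σ (freeEdges V) ω x := by
  have hval : ∀ e ∈ ballEdges x, (EOpen σ (freeEdges V) ω e ↔ σ = Phase.ord) := by
    intro e he
    obtain ⟨heE, hxe⟩ := mem_ballEdges_iff.1 he
    have hnt : ¬ HullTouch Γ e := fun ⟨γ, hγ, z, hz, hzh⟩ => hfar γ hγ z (mem_coBall_iff.1 hxe z hz) hzh
    have hI : e ∉ IntEdges Γ := by
      intro hI
      obtain ⟨γ, hγ, A, hA, heA⟩ := (mem_IntEdges).1 hI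
      induction e using Sym2.ind with
      | h u v =>
        have huA : u ∈ A := inner1_subset A (core_subset_inner1 A ((mem_freeEdges.1 heA).2 (mem_coBall_of_mem heE (Sym2.mem_mk_left u v))))
        exact hnt ⟨γ, hγ, u, Sym2.mem_mk_left u v, (subset_intr_of_mem_ints (S := rcSetup d) hA).trans (intr_subset_hull (S := rcSetup d) γ) huA⟩
    rw [hspec e heE, SpecFam, OpenFam]
    constructor
    · rintro (⟨h, -⟩ | ⟨-, ⟨γ, hγ, ht, -⟩ | ⟨-, h⟩⟩)
      · exact absurd h hI
      · exact absurd ⟨γ, hγ, ht⟩ hnt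
      · exact h
    · intro h; exact Or.inr ⟨hI, Or.inr ⟨hnt, h⟩⟩
  rintro ⟨hno, hnd⟩
  cases hσ : σ with
  | ord => exact hno fun e he => (hval e he).2 hσ
  | dis => exact hnd fun e he ho => by have := (hval e he).1 ho; rw [hσ] at this; exact absurd this (by decide)

include hd in
/-- **Location trichotomy**: every site is near the support of a member, or has its ball inside an interior
component of a member, or its ball misses every hull. [folklore] -/
theorem location (x : Site d) :
    (∃ γ ∈ Γ, x ∈ γ.1.supp ∨ x ∈ exBoundary γ.1.supp) ∨
      (∃ γ ∈ Γ, ∃ A ∈ (rcSetup d).ints γ, starBall x ⊆ A) ∨ (∀ γ ∈ Γ, ∀ z ∈ starBall x, z ∉ (rcSetup d).hull γ) := by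
  by_cases h1 : ∃ γ ∈ Γ, x ∈ γ.1.supp ∨ x ∈ exBoundary γ.1.supp
  · exact Or.inl h1
  by_cases h3 : ∀ γ ∈ Γ, ∀ z ∈ starBall x, z ∉ (rcSetup d).hull γ
  · exact Or.inr (Or.inr h3)
  push Not at h1 h3
  obtain ⟨γ, hγ, z, hz, hzh⟩ := h3
  obtain ⟨hxS, hxb⟩ := h1 γ hγ
  -- no support point in the ball of `x`
  have hball : ∀ y ∈ starBall x, y ∉ γ.1.supp := fun y hy hyS => by
    by_cases hyx : y = x
    · exact hxS (hyx ▸ hyS)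
    · exact hxb (mem_exBoundary.2 ⟨hxS, y, hyS, adj_iff_mem_starBall.2 ⟨mem_starBall_comm.1 hy, hyx⟩⟩)
  have hzi : z ∈ starInt γ.1.supp := by
    rcases (mem_hull_iff hd (S := rcSetup d)).1 hzh with h | h
    · exact absurd h (hball z hz)
    · exact h
  have hxA : x ∈ starIntComp γ.1.supp z := by
    by_cases hzx : z = x
    · exact hzx ▸ mem_starIntComp_self hd hzi
    · exact mem_starIntComp_of_starRel hd hzi (mem_starIntComp_self hd hzi)
        ⟨adj_iff_mem_starBall.2 ⟨mem_starBall_comm.1 hz, hzx⟩, fun h => hball z hz (mem_coe.1 h), fun h => hxS (mem_coe.1 h)⟩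
  refine Or.inr (Or.inl ⟨γ, hγ, starIntComp γ.1.supp z, mem_ints.2 ⟨z, hzi, rfl⟩, fun y hy => ?_⟩)
  by_cases hyx : x = y
  · exact hyx ▸ hxA
  · exact mem_starIntComp_of_starRel hd hzi hxA ⟨adj_iff_mem_starBall.2 ⟨hy, hyx⟩, fun h => hxS (mem_coe.1 h), fun h => hball y hy (mem_coe.1 h)⟩

include hd hspec in
/-- **The bad sites of a specified configuration**: the intrinsically bad sites of the members and the bad
sites of the block configurations. [cite: FriedliVelenik2017, §7.3, proof of (7.28)–(7.30)] -/
theorem bad_iff_of_spec (hΓ : Γ ∈ (rcSetup d).ExtFam σ V) (x : Site d) :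
    Bad σ (freeEdges V) ω x ↔ (∃ γ ∈ Γ, x ∈ γ.1.supp ∧ γ.1.IBad x) ∨
      (∃ γ ∈ Γ, ∃ A ∈ (rcSetup d).ints γ, Bad (γ.1.lab A) (freeEdges A) (U ∩ freeEdges A) x) := by
  -- a block-bad site has its ball inside the block
  have hblock : ∀ {γ A}, γ ∈ Γ → A ∈ (rcSetup d).ints γ → Bad (γ.1.lab A) (freeEdges A) (U ∩ freeEdges A) x → starBall x ⊆ A :=
    fun _ _ hb => (starBall_subset_inner1_of_mem_core (bad_subset_core inter_subset_right hb)).trans (inner1_subset _)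
  rcases location hd (Γ := Γ) x with ⟨γ, hγ, hx⟩ | ⟨γ, hγ, A, hA, hxA⟩ | hfar
  · -- near the support of `γ`
    rw [bad_iff_iBad_of_spec hd hspec hΓ hγ hx]
    obtain ⟨-, h2, -, -, -, -⟩ := WF.consistency hd γ.2
    have hnb : ∀ {γ' A}, γ' ∈ Γ → A ∈ (rcSetup d).ints γ' → ¬ Bad (γ'.1.lab A) (freeEdges A) (U ∩ freeEdges A) x := by
      intro γ' A hγ' hA hb
      have hxA := hblock hγ' hA hb
      have hAh : A ⊆ (rcSetup d).hull γ' := (subset_intr_of_mem_ints (S := rcSetup d) hA).trans (intr_subset_hull (S := rcSetup d) γ')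
      have hAS := disjoint_supp_of_mem_ints hd (S := rcSetup d) hA
      rcases hx with hxS | hxb
      · have := eq_of_mem_hull hΓ hγ hγ' (supp_subset_hull hd (S := rcSetup d) γ hxS) (hAh (hxA (mem_starBall_self x)))
        subst this; exact Finset.disjoint_left.1 hAS (hxA (mem_starBall_self x)) hxS
      · obtain ⟨-, s, hs, hsx⟩ := mem_exBoundary.1 hxb
        have hsA : s ∈ A := hxA (mem_starBall_comm.1 (adj_iff_mem_starBall.1 hsx).1)
        have := eq_of_mem_hull hΓ hγ hγ' (supp_subset_hull hd (S := rcSetup d) γ hs) (hAh hsA)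
        subst this; exact Finset.disjoint_left.1 hAS hsA hs
    constructor
    · intro hb
      rcases hx with hxS | hxb
      · exact Or.inl ⟨γ, hγ, hxS, hb⟩
      · exact absurd hb (h2 x hxb).1
    · rintro (⟨γ', hγ', hxS', hb⟩ | ⟨γ', hγ', A, hA, hb⟩)
      · rcases hx with hxS | hxb
        · have := eq_of_mem_hull hΓ hγ hγ' (supp_subset_hull hd (S := rcSetup d) γ hxS) (supp_subset_hull hd (S := rcSetup d) γ' hxS')
          subst this; exact hb
        · exfalso
          obtain ⟨hxS, s, hs, hsx⟩ := mem_exBoundary.1 hxb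
          have hne : γ ≠ γ' := fun h => hxS (h ▸ hxS')
          exact absurd (zdStar_adj.1 hsx).2 (not_le.2 (one_lt_supDist_of_mem hΓ hγ hγ' hne hs hxS'))
      · exact absurd hb (hnb hγ' hA)
  · -- deep inside the interior component `A`
    rw [bad_iff_bad_block_of_spec hd hspec hΓ hγ hA hxA]
    constructor
    · intro hb; exact Or.inr ⟨γ, hγ, A, hA, hb⟩
    · rintro (⟨γ', hγ', hxS', -⟩ | ⟨γ', hγ', A', hA', hb⟩)
      · exfalso
        have hAh : A ⊆ (rcSetup d).hull γ := (subset_intr_of_mem_ints (S := rcSetup d) hA).trans (intr_subset_hull (S := rcSetup d) γ)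
        have := eq_of_mem_hull hΓ hγ hγ' (hAh (hxA (mem_starBall_self x))) (supp_subset_hull hd (S := rcSetup d) γ' hxS')
        subst this
        exact Finset.disjoint_left.1 (disjoint_supp_of_mem_ints hd (S := rcSetup d) hA) (hxA (mem_starBall_self x)) hxS'
      · obtain ⟨rfl, rfl⟩ := eq_of_mem_ints_of_mem hΓ hd hγ hγ' hA hA' (hxA (mem_starBall_self x)) (hblock hγ' hA' hb (mem_starBall_self x))
        exact hb
  · -- far from all hulls
    constructor
    · intro hb; exact absurd hb (not_bad_of_far hspec hfar)
    · rintro (⟨γ, hγ, hxS, -⟩ | ⟨γ, hγ, A, hA, hb⟩)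
      · exact absurd (supp_subset_hull hd (S := rcSetup d) γ hxS) (hfar γ hγ x (mem_starBall_self x))
      · exact absurd ((subset_intr_of_mem_ints (S := rcSetup d) hA).trans (intr_subset_hull (S := rcSetup d) γ)
          (hblock hγ hA hb (mem_starBall_self x))) (hfar γ hγ x (mem_starBall_self x))

include hd hω hspec in
/-- **The thick bad set of a specified configuration**: the supports of the members and the thick bad sets of
the block configurations. [cite: FriedliVelenik2017, §7.3] -/
theorem mem_thick_iff_of_spec (hΓ : Γ ∈ (rcSetup d).ExtFam σ V) (y : Site d) :
    y ∈ thick σ (freeEdges V) ω ↔ (∃ γ ∈ Γ, y ∈ γ.1.supp) ∨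
      (∃ γ ∈ Γ, ∃ A ∈ (rcSetup d).ints γ, y ∈ thick (γ.1.lab A) (freeEdges A) (U ∩ freeEdges A)) := by
  rw [mem_thick hω]
  constructor
  · rintro ⟨b, hb, hyb⟩
    rcases (bad_iff_of_spec hd hspec hΓ b).1 hb with ⟨γ, hγ, hbS, hbad⟩ | ⟨γ, hγ, A, hA, hbad⟩
    · obtain ⟨h1, -⟩ := WF.consistency hd γ.2
      exact Or.inl ⟨γ, hγ, (h1 y).2 ⟨b, hbS, hbad, hyb⟩⟩
    · exact Or.inr ⟨γ, hγ, A, hA, (mem_thick inter_subset_right).2 ⟨b, hbad, hyb⟩⟩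
  · rintro (⟨γ, hγ, hyS⟩ | ⟨γ, hγ, A, hA, hy⟩)
    · obtain ⟨h1, -⟩ := WF.consistency hd γ.2
      obtain ⟨b, hbS, hbad, hyb⟩ := (h1 y).1 hyS
      exact ⟨b, (bad_iff_of_spec hd hspec hΓ b).2 (Or.inl ⟨γ, hγ, hbS, hbad⟩), hyb⟩
    · obtain ⟨b, hbad, hyb⟩ := (mem_thick inter_subset_right).1 hy
      exact ⟨b, (bad_iff_of_spec hd hspec hΓ b).2 (Or.inr ⟨γ, hγ, A, hA, hbad⟩), hyb⟩

end Specified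

/-! ### 4. Supports, external contours and the extracted contours of a specified configuration -/

/-- Extensionality for contours. [folklore] -/
theorem Contour.ext' {c c' : Contour d} (h1 : c.supp = c'.supp) (h2 : c.openE = c'.openE) (h3 : c.ordB = c'.ordB) : c = c' := by
  cases c; cases c'; simp_all

section Supports

variable (hd : 2 ≤ d) {σ : Phase} {V : Finset (Site d)} (hV : StarConn (V : Set (Site d))ᶜ)
  {Γ : Finset (rcSetup d).Γ} (hΓ : Γ ∈ (rcSetup d).ExtFam σ V)
  {U ω : Finset (Sym2 (Site d))} (hω : ω ⊆ freeEdges V)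
  (hspec : ∀ e ∈ (zdGraph d).edgeSet, EOpen σ (freeEdges V) ω e ↔ SpecFam σ Γ U e)

/-- The thick bad set of a block configuration keeps balls inside the block. [cite: FriedliVelenik2017, §7.3, Lemma 7.20] -/
theorem starBall_subset_of_mem_thick_block {A : Finset (Site d)} {y : Site d}
    (hy : y ∈ thick σ (freeEdges A) (U ∩ freeEdges A)) : starBall y ⊆ A :=
  mem_inner1.1 (thick_subset_inner1 inter_subset_right hy)

include hd hω hspec in
/-- **Separation, I**: a thick site `★`-adjacent to the support of a member lies on that support. [folklore] -/
theorem mem_supp_of_adj_thick (hΓ : Γ ∈ (rcSetup d).ExtFam σ V) {γ : (rcSetup d).Γ} (hγ : γ ∈ Γ) {s y : Site d}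
    (hs : s ∈ γ.1.supp) (hy : y ∈ thick σ (freeEdges V) ω) (hsy : (zdStar d).Adj s y) : y ∈ γ.1.supp := by
  rcases (mem_thick_iff_of_spec hd hω hspec hΓ y).1 hy with ⟨γ', hγ', hyS'⟩ | ⟨γ', hγ', A, hA, hyA⟩
  · by_cases hne : γ = γ'
    · subst hne; exact hyS'
    · exact absurd (zdStar_adj.1 hsy).2 (not_le.2 (one_lt_supDist_of_mem hΓ hγ hγ' hne hs hyS'))
  · exfalso
    have hsA : s ∈ A := starBall_subset_of_mem_thick_block hyA (mem_starBall_comm.1 (adj_iff_mem_starBall.1 hsy).1)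
    have hAh : A ⊆ (rcSetup d).hull γ' := (subset_intr_of_mem_ints (S := rcSetup d) hA).trans (intr_subset_hull (S := rcSetup d) γ')
    have := eq_of_mem_hull hΓ hγ hγ' (supp_subset_hull hd (S := rcSetup d) γ hs) (hAh hsA)
    subst this
    exact Finset.disjoint_left.1 (disjoint_supp_of_mem_ints hd (S := rcSetup d) hA) hsA hs

include hd hω hspec in
/-- **Separation, II**: a thick site `★`-adjacent to the thick set of a block lies in that thick set. [folklore] -/
theorem mem_thick_block_of_adj (hΓ : Γ ∈ (rcSetup d).ExtFam σ V) {γ : (rcSetup d).Γ} (hγ : γ ∈ Γ) {A : Finset (Site d)}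
    (hA : A ∈ (rcSetup d).ints γ) {y y' : Site d} (hy : y ∈ thick (γ.1.lab A) (freeEdges A) (U ∩ freeEdges A))
    (hy' : y' ∈ thick σ (freeEdges V) ω) (hyy' : (zdStar d).Adj y y') : y' ∈ thick (γ.1.lab A) (freeEdges A) (U ∩ freeEdges A) := by
  have hy'A : y' ∈ A := starBall_subset_of_mem_thick_block hy (adj_iff_mem_starBall.1 hyy').1
  rcases (mem_thick_iff_of_spec hd hω hspec hΓ y').1 hy' with ⟨γ', hγ', hyS'⟩ | ⟨γ', hγ', A', hA', hyA'⟩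
  · exfalso
    have hAh : A ⊆ (rcSetup d).hull γ := (subset_intr_of_mem_ints (S := rcSetup d) hA).trans (intr_subset_hull (S := rcSetup d) γ)
    have := eq_of_mem_hull hΓ hγ hγ' (hAh hy'A) (supp_subset_hull hd (S := rcSetup d) γ' hyS')
    subst this
    exact Finset.disjoint_left.1 (disjoint_supp_of_mem_ints hd (S := rcSetup d) hA) hy'A hyS'
  · obtain ⟨rfl, rfl⟩ := eq_of_mem_ints_of_mem hΓ hd hγ hγ' hA hA' hy'A (starBall_subset_of_mem_thick_block hyA' (mem_starBall_self y'))
    exact hyA'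

include hd hω hspec in
/-- **The component of the thick bad set through a support point of a member is that support.** [cite: FriedliVelenik2017, §7.3] -/
theorem suppAt_eq_supp_of_spec (hΓ : Γ ∈ (rcSetup d).ExtFam σ V) {γ : (rcSetup d).Γ} (hγ : γ ∈ Γ) {z : Site d} (hz : z ∈ γ.1.supp) :
    suppAt σ (freeEdges V) ω z = γ.1.supp := by
  have hsub : (γ.1.supp : Set (Site d)) ⊆ (thick σ (freeEdges V) ω : Set (Site d)) := fun w hw =>
    mem_coe.2 ((mem_thick_iff_of_spec hd hω hspec hΓ w).2 (Or.inl ⟨γ, hγ, mem_coe.1 hw⟩))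
  have hzt : z ∈ thick σ (freeEdges V) ω := mem_coe.1 (hsub (mem_coe.2 hz))
  ext y
  rw [mem_suppAt hzt]
  constructor
  · intro h
    induction h with
    | refl => exact hz
    | tail _ hbc ih => exact mem_supp_of_adj_thick hd hω hspec hΓ hγ ih (mem_coe.1 hbc.2.2) hbc.1
  · intro hy
    exact reflTransGen_starRel_mono hsub ((rcSetup d).supp_starConn γ z (mem_coe.2 hz) y (mem_coe.2 hy))

include hd hω hspec in
/-- **The component of the thick bad set through a point of a block's thick set is the block's component.** [folklore] -/
theorem suppAt_eq_suppAt_block_of_spec (hΓ : Γ ∈ (rcSetup d).ExtFam σ V) {γ : (rcSetup d).Γ} (hγ : γ ∈ Γ) {A : Finset (Site d)}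
    (hA : A ∈ (rcSetup d).ints γ) {z : Site d} (hz : z ∈ thick (γ.1.lab A) (freeEdges A) (U ∩ freeEdges A)) :
    suppAt σ (freeEdges V) ω z = suppAt (γ.1.lab A) (freeEdges A) (U ∩ freeEdges A) z := by
  have hsub : (thick (γ.1.lab A) (freeEdges A) (U ∩ freeEdges A) : Set (Site d)) ⊆ (thick σ (freeEdges V) ω : Set (Site d)) :=
    fun w hw => mem_coe.2 ((mem_thick_iff_of_spec hd hω hspec hΓ w).2 (Or.inr ⟨γ, hγ, A, hA, mem_coe.1 hw⟩))
  have hzt : z ∈ thick σ (freeEdges V) ω := mem_coe.1 (hsub (mem_coe.2 hz))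
  ext y
  rw [mem_suppAt hzt, mem_suppAt hz]
  constructor
  · intro h
    suffices key : ReflTransGen (starRel (thick (γ.1.lab A) (freeEdges A) (U ∩ freeEdges A) : Set (Site d))) z y ∧
        y ∈ thick (γ.1.lab A) (freeEdges A) (U ∩ freeEdges A) from key.1
    induction h with
    | refl => exact ⟨ReflTransGen.refl, hz⟩
    | tail _ hbc ih =>
      have hc := mem_thick_block_of_adj hd hω hspec hΓ hγ hA ih.2 (mem_coe.1 hbc.2.2) hbc.1
      exact ⟨ih.1.tail ⟨hbc.1, mem_coe.2 ih.2, mem_coe.2 hc⟩, hc⟩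
  · intro h; exact reflTransGen_starRel_mono hsub h

include hd hω hspec in
/-- **The supports of a specified configuration**: the supports of the members and the supports of the block
configurations. [cite: FriedliVelenik2017, §7.3, proof of (7.29)–(7.30)] -/
theorem mem_supports_iff_of_spec (hΓ : Γ ∈ (rcSetup d).ExtFam σ V) (S : Finset (Site d)) :
    S ∈ supports σ (freeEdges V) ω ↔ (∃ γ ∈ Γ, S = γ.1.supp) ∨
      (∃ γ ∈ Γ, ∃ A ∈ (rcSetup d).ints γ, S ∈ supports (γ.1.lab A) (freeEdges A) (U ∩ freeEdges A)) := by
  rw [mem_supports]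
  constructor
  · rintro ⟨z, hz, rfl⟩
    rcases (mem_thick_iff_of_spec hd hω hspec hΓ z).1 hz with ⟨γ, hγ, hzS⟩ | ⟨γ, hγ, A, hA, hzA⟩
    · exact Or.inl ⟨γ, hγ, suppAt_eq_supp_of_spec hd hω hspec hΓ hγ hzS⟩
    · exact Or.inr ⟨γ, hγ, A, hA, mem_supports.2 ⟨z, hzA, (suppAt_eq_suppAt_block_of_spec hd hω hspec hΓ hγ hA hzA).symm⟩⟩
  · rintro (⟨γ, hγ, rfl⟩ | ⟨γ, hγ, A, hA, hS⟩)
    · obtain ⟨z, hz⟩ := (rcSetup d).supp_nonempty γ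
      exact ⟨z, (mem_thick_iff_of_spec hd hω hspec hΓ z).2 (Or.inl ⟨γ, hγ, hz⟩), suppAt_eq_supp_of_spec hd hω hspec hΓ hγ hz⟩
    · obtain ⟨z, hz, rfl⟩ := mem_supports.1 hS
      exact ⟨z, (mem_thick_iff_of_spec hd hω hspec hΓ z).2 (Or.inr ⟨γ, hγ, A, hA, hz⟩),
        suppAt_eq_suppAt_block_of_spec hd hω hspec hΓ hγ hA hz⟩

/-- The support of a member as a bare contour. [folklore] -/
def rawOf (γ : (rcSetup d).Γ) : (rawSetup d).Γ := ⟨γ.1.supp, (WF.supp_nonempty_starConn γ.2).1, (WF.supp_nonempty_starConn γ.2).2⟩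

/-- Interior components agree. [folklore] -/
theorem ints_rawOf (γ : (rcSetup d).Γ) : (rawSetup d).ints (rawOf γ) = (rcSetup d).ints γ := rfl

/-- The hull of an inner support lies in its block. [cite: FriedliVelenik2017, §7.3] -/
theorem hull_subset_block (hd : 2 ≤ d) {γ : (rcSetup d).Γ} {A : Finset (Site d)} (hA : A ∈ (rcSetup d).ints γ)
    {T : (rawSetup d).Γ} (hS : T.1 ∈ supports σ (freeEdges A) (U ∩ freeEdges A)) : (rawSetup d).hull T ⊆ A := by
  have hin : (rawSetup d).InVol T A := by
    change T.1.biUnion starBall ⊆ A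
    exact biUnion_starBall_subset_of_mem_supports inter_subset_right hS
  exact hull_subset_of_inVol hd (starConn_compl_of_mem_ints hd (S := rcSetup d) hA) hin

include hd hω hspec in
/-- **The hull-maximal supports of a specified configuration are the supports of the members.**
[cite: FriedliVelenik2017, §7.3, Def. 7.22] -/
theorem mem_maxSupports_iff_of_spec (hΓ : Γ ∈ (rcSetup d).ExtFam σ V) (T : (rawSetup d).Γ) :
    T ∈ maxSupports σ (freeEdges V) ω ↔ ∃ γ ∈ Γ, T.1 = γ.1.supp := by
  classical
  rw [maxSupports, mem_maxP]
  constructor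
  · rintro ⟨hT, -, hmax⟩
    rcases (mem_supports_iff_of_spec hd hω hspec hΓ T.1).1 (mem_rawSupports.1 hT) with ⟨γ, hγ, h⟩ | ⟨γ, hγ, A, hA, hS⟩
    · exact ⟨γ, hγ, h⟩
    · exfalso
      have hTγ : rawOf γ ∈ rawSupports σ (freeEdges V) ω :=
        mem_rawSupports.2 ((mem_supports_iff_of_spec hd hω hspec hΓ _).2 (Or.inl ⟨γ, hγ, rfl⟩))
      exact hmax _ hTγ trivial ⟨A, by rw [ints_rawOf]; exact hA, hull_subset_block hd hA hS⟩
  · rintro ⟨γ, hγ, hT⟩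
    refine ⟨mem_rawSupports.2 ((mem_supports_iff_of_spec hd hω hspec hΓ _).2 (Or.inl ⟨γ, hγ, hT⟩)), trivial, ?_⟩
    rintro T' hT' - ⟨A', hA', hsub⟩
    obtain ⟨x, hx⟩ := (rcSetup d).supp_nonempty γ
    have hxT : x ∈ (rawSetup d).hull T := supp_subset_hull hd (S := rawSetup d) T (by rw [show (rawSetup d).supp T = T.1 from rfl, hT]; exact hx)
    have hxA' : x ∈ A' := hsub hxT
    have hA'h : A' ⊆ (rawSetup d).hull T' :=
      (subset_intr_of_mem_ints (S := rawSetup d) hA').trans (intr_subset_hull (S := rawSetup d) T')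
    rcases (mem_supports_iff_of_spec hd hω hspec hΓ T'.1).1 (mem_rawSupports.1 hT') with ⟨γ', hγ', h'⟩ | ⟨γ', hγ', A'', hA'', hS'⟩
    · have hA'γ : A' ∈ (rcSetup d).ints γ' := by
        have := hA'; change A' ∈ (starInt T'.1).image (starIntComp T'.1) at this; rw [h'] at this; exact this
      have hAh : A' ⊆ (rcSetup d).hull γ' := (subset_intr_of_mem_ints (S := rcSetup d) hA'γ).trans (intr_subset_hull (S := rcSetup d) γ')
      have := eq_of_mem_hull hΓ hγ hγ' (supp_subset_hull hd (S := rcSetup d) γ hx) (hAh hxA')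
      subst this
      exact Finset.disjoint_left.1 (disjoint_supp_of_mem_ints hd (S := rcSetup d) hA'γ) hxA' hx
    · have hxA'' : x ∈ A'' := hull_subset_block hd hA'' hS' (hA'h hxA')
      have hAh : A'' ⊆ (rcSetup d).hull γ' := (subset_intr_of_mem_ints (S := rcSetup d) hA'').trans (intr_subset_hull (S := rcSetup d) γ')
      have := eq_of_mem_hull hΓ hγ hγ' (supp_subset_hull hd (S := rcSetup d) γ hx) (hAh hxA'')
      subst this
      exact Finset.disjoint_left.1 (disjoint_supp_of_mem_ints hd (S := rcSetup d) hA'') hxA'' hx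

include hd hspec in
/-- **The contour extracted at the support of a member is that member.** [cite: FriedliVelenik2017, §7.2.6, Def. 7.18] -/
theorem contourAt_eq_of_spec (hΓ : Γ ∈ (rcSetup d).ExtFam σ V) {γ : (rcSetup d).Γ} (hγ : γ ∈ Γ) :
    contourAt σ (freeEdges V) ω γ.1.supp = γ.1 := by
  obtain ⟨-, h2, -, -, h5, h6⟩ := WF.consistency hd γ.2
  refine Contour.ext' rfl ?_ ?_
  · ext e
    change e ∈ (nnEdges γ.1.supp).filter (fun e => EOpen σ (freeEdges V) ω e) ↔ e ∈ γ.1.openE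
    rw [mem_filter]
    induction e using Sym2.ind with
    | h u v =>
      constructor
      · rintro ⟨he, ho⟩
        obtain ⟨huv, hu, -⟩ := mk_mem_nnEdges.1 he
        have hio := (eOpen_iff_isOpen_of_spec hd hΓ hspec hγ (Or.inl hu) (mk_mem_ballEdges_of_mem_nbrs (mem_nbrs.2 huv))).1 ho
        rcases hio with h | ⟨h, -⟩
        · exact h
        · exact absurd he h
      · intro h
        have he : s(u, v) ∈ nnEdges γ.1.supp := h5 h
        obtain ⟨huv, hu, -⟩ := mk_mem_nnEdges.1 he
        exact ⟨he, (eOpen_iff_isOpen_of_spec hd hΓ hspec hγ (Or.inl hu) (mk_mem_ballEdges_of_mem_nbrs (mem_nbrs.2 huv))).2 (Or.inl h)⟩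
  · ext y
    change y ∈ (exBoundary γ.1.supp).filter (fun y => OrdGood σ (freeEdges V) ω y) ↔ y ∈ γ.1.ordB
    rw [mem_filter]
    constructor
    · rintro ⟨hy, hog⟩
      refine (h2 y hy).2.1.1 fun e he => ?_
      exact (eOpen_iff_isOpen_of_spec hd hΓ hspec hγ (Or.inr hy) he).1 (hog e he)
    · intro h
      have hy := h6 h
      exact ⟨hy, fun e he => (eOpen_iff_isOpen_of_spec hd hΓ hspec hγ (Or.inr hy) he).2 ((h2 y hy).2.1.2 h e he)⟩

include hd hspec in
/-- **The external contours of a specified configuration are the family.** [cite: FriedliVelenik2017, §7.3, eqs. (7.29)–(7.30)] -/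
theorem extContours_eq_of_spec (hΓ : Γ ∈ (rcSetup d).ExtFam σ V) : extContours σ hω = Γ := by
  ext γ₀
  rw [mem_extContours]
  constructor
  · rintro ⟨T, hT, hγ₀⟩
    obtain ⟨γ, hγ, hT1⟩ := (mem_maxSupports_iff_of_spec hd hω hspec hΓ T).1 hT
    rw [hT1, contourAt_eq_of_spec hd hspec hΓ hγ] at hγ₀
    rw [Subtype.ext hγ₀]; exact hγ
  · intro hγ₀
    exact ⟨rawOf γ₀, (mem_maxSupports_iff_of_spec hd hω hspec hΓ _).2 ⟨γ₀, hγ₀, rfl⟩, (contourAt_eq_of_spec hd hspec hΓ hγ₀).symm⟩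

end Supports

/-! ### 5. Genuine configurations are specified by their external contours; the glued configuration -/

section Genuine

variable (hd : 2 ≤ d) {σ : Phase} {V : Finset (Site d)} (hV : StarConn (V : Set (Site d))ᶜ)

include hd hV in
/-- **A configuration of the volume is specified by its external contours and its interior edges.**
[cite: FriedliVelenik2017, §7.3, proof of (7.28)–(7.30)] -/
theorem specFam_extContours {ω : Finset (Sym2 (Site d))} (hω : ω ⊆ freeEdges V) {e : Sym2 (Site d)} (heE : e ∈ (zdGraph d).edgeSet) :
    EOpen σ (freeEdges V) ω e ↔ SpecFam σ (extContours σ hω) (ω ∩ IntEdges (extContours σ hω)) e := by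
  have hΓ := extContours_mem_extFam hd hω (σ := σ)
  set Γ := extContours σ hω with hΓdef
  by_cases heF : e ∈ freeEdges V
  swap
  · rw [eOpen_iff_of_not_mem hω heF, specFam_iff_of_not_mem_freeEdges hd hV hΓ _ heE heF]
  rw [eOpen_iff_of_mem heF, SpecFam]
  by_cases hI : e ∈ IntEdges Γ
  · rw [mem_inter]; constructor
    · intro h; exact Or.inl ⟨hI, h, hI⟩
    · rintro (⟨-, h, -⟩ | ⟨h, -⟩)
      · exact h
      · exact absurd hI h
  -- a determined free edge
  suffices key : e ∈ ω ↔ OpenFam σ Γ e by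
    rw [key]; constructor
    · intro h; exact Or.inr ⟨hI, h⟩
    · rintro (⟨h, -⟩ | ⟨-, h⟩)
      · exact absurd h hI
      · exact h
  rw [← eOpen_iff_of_mem heF]
  induction e using Sym2.ind with
  | h u v =>
    have huv : (zdGraph d).Adj u v := (SimpleGraph.mem_edgeSet _).1 heE
    by_cases hsupp : ∃ γ ∈ Γ, ∃ z ∈ s(u, v), z ∈ γ.1.supp
    · -- an endpoint on a support: agreement on balls of support sites
      obtain ⟨γ, hγ, z, hz, hzS⟩ := hsupp
      obtain ⟨hs, T, hT, hTs⟩ := supp_mem_of_mem_extContours hγ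
      obtain ⟨T', hT', hγT⟩ := mem_extContours.1 hγ
      have hTs' : T'.1 = γ.1.supp := by rw [hγT]; rfl
      have hball : s(u, v) ∈ ballEdges z := mem_ballEdges_iff.2 ⟨heE, mem_coBall_of_mem heE hz⟩
      rw [(openFam_iff_isOpen hd hΓ hγ (Or.inl hzS) hball).2, hγT, hTs']
      exact (isOpen_iff_eOpen_of_mem_supp hω hs hd hzS hball).symm
    push Not at hsupp
    by_cases ht : HullTouch Γ s(u, v)
    · -- inside an interior component
      obtain ⟨γ, hγ, z, hz, hzh⟩ := ht
      have hzi : z ∈ (rcSetup d).intr γ := ((mem_hull_iff hd (S := rcSetup d)).1 hzh).resolve_left (hsupp γ hγ z hz)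
      obtain ⟨A, hA, hzA⟩ := (mem_intr_iff_exists_ints hd (S := rcSetup d)).1 hzi
      have hAh : A ⊆ (rcSetup d).hull γ := (subset_intr_of_mem_ints (S := rcSetup d) hA).trans (intr_subset_hull (S := rcSetup d) γ)
      -- both endpoints in `A`
      have hboth : u ∈ A ∧ v ∈ A := by
        have hother : ∀ {a b}, s(a, b) = s(u, v) → a ∈ A → (zdGraph d).Adj a b → b ∈ A := by
          intro a b hab ha hadj
          have hbS : b ∉ γ.1.supp := hsupp γ hγ b (hab ▸ Sym2.mem_mk_right a b)
          exact mem_of_adj_of_mem_ints hd (S := rcSetup d) hA ha hbS (zdGraph_le_zdStar hadj)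
        rcases Sym2.mem_iff.1 hz with rfl | rfl
        · exact ⟨hzA, hother rfl hzA huv⟩
        · exact ⟨hother Sym2.eq_swap hzA huv.symm, hzA⟩
      have heA : s(u, v) ∉ freeEdges A := fun h => hI ((mem_IntEdges).2 ⟨γ, hγ, A, hA, h⟩)
      rw [eOpen_iff_eOpen_inter hd hω hV hγ hA hboth.1 (mem_nbrs.2 huv), eOpen_iff_of_not_mem inter_subset_right heA, OpenFam]
      change γ.1.lab A = Phase.ord ↔ _
      rw [← isOpen_iff_lab_of_mem hd γ hA hboth.1 hboth.2]
      constructor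
      · intro ho; exact Or.inl ⟨γ, hγ, ⟨z, hz, hzh⟩, ho⟩
      · rintro (⟨γ', hγ', ⟨z', hz', hz'h⟩, ho⟩ | ⟨hnt, -⟩)
        · have := eq_of_touch hd hΓ hγ hγ' heE hz hzh hz' hz'h
          subst this; exact ho
        · exact absurd ⟨γ, hγ, z, hz, hzh⟩ hnt
    · -- off all hulls: the pure phase
      have huV : u ∈ V := inner1_subset V (core_subset_inner1 V ((mem_freeEdges.1 heF).2 (mem_coBall_of_mem heE (Sym2.mem_mk_left u v))))
      have huE : u ∈ Vext σ V hω := mem_filter.2 ⟨huV, fun γ hγ h => ht ⟨γ, hγ, u, Sym2.mem_mk_left u v, h⟩⟩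
      rw [eOpen_iff_of_mem_exteriorAll hd hω ((mem_Vext_iff hd hω).1 huE).2 (mem_nbrs.2 huv), OpenFam]
      constructor
      · intro h; exact Or.inr ⟨ht, h⟩
      · rintro (⟨γ, hγ, htouch, -⟩ | ⟨-, h⟩)
        · exact absurd ⟨γ, hγ, htouch⟩ ht
        · exact h

include hd hV in
/-- **A configuration of the volume is the gluing of its external contours with its interior edges.**
[cite: FriedliVelenik2017, §7.3, eqs. (7.29)–(7.30)] -/
theorem glue_extContours {ω : Finset (Sym2 (Site d))} (hω : ω ⊆ freeEdges V) :
    glue σ V (extContours σ hω) (ω ∩ IntEdges (extContours σ hω)) = ω := by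
  have hΓ := extContours_mem_extFam hd hω (σ := σ)
  ext e
  by_cases heF : e ∈ freeEdges V
  · have heE : e ∈ (zdGraph d).edgeSet := (mem_freeEdges.1 heF).1
    rw [← eOpen_iff_of_mem (σ := σ) (ω := glue σ V (extContours σ hω) (ω ∩ IntEdges (extContours σ hω))) heF,
      eOpen_glue_iff hd hV hΓ inter_subset_right heE, ← specFam_extContours hd hV hω heE, eOpen_iff_of_mem heF]
  · constructor
    · intro h; exact absurd (glue_subset hd hV hΓ inter_subset_right h) heF
    · intro h; exact absurd (hω h) heF

include hd hV in
/-- **The external contours of the glued configuration are the family.** [cite: FriedliVelenik2017, §7.3, eqs. (7.29)–(7.30)] -/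
theorem extContours_glue {Γ : Finset (rcSetup d).Γ} (hΓ : Γ ∈ (rcSetup d).ExtFam σ V) {U : Finset (Sym2 (Site d))} (hU : U ⊆ IntEdges Γ) :
    extContours σ (glue_subset hd hV hΓ hU) = Γ :=
  extContours_eq_of_spec hd (glue_subset hd hV hΓ hU) (fun _ he => eOpen_glue_iff hd hV hΓ hU he) hΓ

end Genuine

end RCC

end Literature.Probability.LatticeModels
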